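import Literature.Geometry.Lorentzian.ChartCalculus
import Literature.Geometry.Lorentzian.LeviCivitaProofs
import Literature.Geometry.Lorentzian.CurvatureSymmetries
import HarnessLib

/-!
# The Levi-Civita connection and the curvature of a metric on an open subset of a normed space,
# in coordinates

Support file (all results proved) for Bartnik's existence theorem for the ADM energy
(`Literature.Geometry.Lorentzian.AFEnd.HasADMEnergy_of_isAsymptoticallyFlat`), whose proof needs
the scalar curvature of the pulled-back metric on `{R < ‖x‖} ⊆ ℝ³` as an explicit expression in
the metric components and their first two derivatives.

Continuing `ChartCalculus.lean` (`U : Opens E`, `g` a smooth metric on `U` with representative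
`G : E → (E →L E →L ℝ)`, `g.val y = G y`; there `∇` was computed on *constant* fields:
`∇_{X₀} Y₀ = Γ_x(Y₀)(X₀) = christoffel g G x Y₀ X₀`), we prove:

* `contDiffAt_repr` — the representative `G` is smooth at the points of `U`;
* `leviCivita_finset_sum` — `∇` is additive over finite sums of differentiable fields;
* `leviCivita_apply_eq` — **the connection in coordinates on arbitrary fields**:
  `∇_{X₀} W (x) = DW(x) X₀ + Γ_x(W x)(X₀)` for a field `W` with differentiable representative
  (O'Neill 1983, Ch. 3, Prop. 3.13 (1)–(2): `D_V W = ∑ (V(W^k) + ∑ Γ^k_{ij} V^i W^j) ∂_k`);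
* `val_riemann_eq` — **the Riemann tensor in coordinates, paired with the metric**:
  `g(R(X₀,Y₀)Z₀, W₀) = ½(∂_{X₀} K(Z₀,Y₀,W₀) − ∂_{Y₀} K(Z₀,X₀,W₀))
     − g(Γ(Z₀)(Y₀), Γ(W₀)(X₀)) + g(Γ(Z₀)(X₀), Γ(W₀)(Y₀))`,
  where `K(Z,Y,W)(y) = koszulForm G y Z Y W = ∂_Y G(Z,W) + ∂_Z G(W,Y) − ∂_W G(Y,Z) = 2 g(Γ(Z)(Y), W)`
  (O'Neill 1983, Ch. 3, Lemma 3.38: `R^i_{jkl} = ∂_k Γ^i_{lj} − ∂_l Γ^i_{kj} + ΓΓ − ΓΓ`, here in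
  the paired, first-kind form which avoids differentiating the inverse metric).

## References

* B. O'Neill, *Semi-Riemannian geometry* (1983), Ch. 3, Prop. 3.13, Lemma 3.35, Lemma 3.38.
* J. M. Lee, *Introduction to Riemannian Manifolds* (2018), (4.9)–(4.10), Prop. 7.4 ff.
-/

noncomputable section

open Bundle Set Function Filter FiberBundle VectorField ContinuousLinearMap TopologicalSpace
open scoped Manifold ContDiff Topology

namespace Literature.Geometry.Lorentzian

namespace OpensChart

variable {E : Type*} [NormedAddCommGroup E] [NormedSpace ℝ E] [FiniteDimensional ℝ E]
  [CompleteSpace E] {U : Opens E}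
  {g : PseudoRiemannianMetric 𝓘(ℝ, E) ∞ E (TangentSpace 𝓘(ℝ, E) : U → Type _)}
  {G : E → E →L[ℝ] E →L[ℝ] ℝ} (hG : ∀ y : U, g.val y = G y)

include hG

/-! ### Regularity of the representative and of constant fields -/

omit [FiniteDimensional ℝ E] [CompleteSpace E] in
/-- The representative `G` of a smooth metric on `U` is smooth at every point of `U`
(`contMDiffAt_bilinSection_iff`). [folklore] -/
theorem contDiffAt_repr (y : U) : ContDiffAt ℝ ∞ G y :=
  (contMDiffAt_bilinSection_iff y g.val G hG).1 (g.contMDiff y)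

omit [FiniteDimensional ℝ E] [CompleteSpace E] in
/-- The representative `G` is differentiable at every point of `U`. [folklore] -/
theorem differentiableAt_repr (y : U) : DifferentiableAt ℝ G y :=
  (contDiffAt_repr hG y).differentiableAt (by simp)

omit hG in
omit [FiniteDimensional ℝ E] [CompleteSpace E] in
/-- Constant vector fields on `U` are smooth sections of `TU`. [folklore] -/
theorem contMDiffAt_const_section (x : U) (v : E) {m : ℕ∞ω} :
    ContMDiffAt 𝓘(ℝ, E) (𝓘(ℝ, E).prod 𝓘(ℝ, E)) m
      (fun y : U ↦ (TotalSpace.mk' E y (v : TangentSpace 𝓘(ℝ, E) y) : TangentBundle 𝓘(ℝ, E) U))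
      x := by
  rw [contMDiffAt_section_iff]
  exact contMDiffAt_const

omit hG in
omit [FiniteDimensional ℝ E] [CompleteSpace E] in
/-- Constant vector fields on `U` are smooth on every set. [folklore] -/
theorem contMDiffOn_const_section (s : Set U) (v : E) {m : ℕ∞ω} :
    ContMDiffOn 𝓘(ℝ, E) (𝓘(ℝ, E).prod 𝓘(ℝ, E)) m
      (fun y : U ↦ (TotalSpace.mk' E y (v : TangentSpace 𝓘(ℝ, E) y) : TangentBundle 𝓘(ℝ, E) U))
      s :=
  fun x _ ↦ (contMDiffAt_const_section x v).contMDiffWithinAt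

/-! ### Additivity over finite sums -/

omit hG in
omit [FiniteDimensional ℝ E] [CompleteSpace E] in
/-- The covariant derivative of a finite sum of fields differentiable at `x` is the sum of the
covariant derivatives (Mathlib's `IsCovariantDerivativeOn.add`, iterated). [folklore] -/
theorem leviCivita_finset_sum [g.HasLeviCivita] (x : U) {ι : Type*} (s : Finset ι)
    (σ : ι → Π y : U, TangentSpace 𝓘(ℝ, E) y) (h : ∀ i ∈ s, MDiffAt (T% (σ i)) x) :
    g.leviCivita (fun y ↦ ∑ i ∈ s, σ i y) x = ∑ i ∈ s, g.leviCivita (σ i) x := by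
  classical
  induction s using Finset.induction_on with
  | empty =>
    simp only [Finset.sum_empty]
    exact congrFun g.leviCivita.zero x
  | insert a s ha ih =>
    have hs : ∀ i ∈ s, MDiffAt (T% (σ i)) x := fun i hi ↦ h i (Finset.mem_insert_of_mem hi)
    have hsum : MDiffAt (T% (fun y ↦ ∑ i ∈ s, σ i y)) x := MDifferentiableAt.sum_section hs
    have heq : (fun y ↦ ∑ i ∈ insert a s, σ i y) = σ a + fun y ↦ ∑ i ∈ s, σ i y := by
      funext y
      rw [Finset.sum_insert ha]
      rfl
    rw [heq, g.leviCivita.isCovariantDerivativeOn.add (h a (Finset.mem_insert_self a s)) hsum,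
      Finset.sum_insert ha, ih hs]

/-! ### The connection on arbitrary fields -/

omit hG in
omit [CompleteSpace E] in
/-- The Christoffel map is additive over finite sums in its field argument. [folklore] -/
theorem christoffel_finset_sum (x : U) {ι : Type*} (s : Finset ι) (c : ι → ℝ) (v : ι → E)
    (X₀ : E) :
    christoffel g G x (∑ i ∈ s, c i • v i) X₀ = ∑ i ∈ s, c i • christoffel g G x (v i) X₀ := by
  classical
  induction s using Finset.induction_on with
  | empty =>
    simp only [Finset.sum_empty]
    have h := christoffel_smul (g := g) (G := G) x 0 X₀ X₀
    rw [zero_smul, zero_smul] at h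
    exact h
  | insert a s ha ih =>
    rw [Finset.sum_insert ha, Finset.sum_insert ha, christoffel_add, christoffel_smul, ih]

omit [CompleteSpace E] in
/-- **The Levi-Civita connection in coordinates, on arbitrary fields** (O'Neill 1983, Ch. 3,
Prop. 3.13 (1)–(2)): for a vector field `W` on `U` with representative `Wf : E → E`
(`W y = Wf y`) differentiable at `x`,
`∇_{X₀} W (x) = DWf(x) X₀ + Γ_x(W x)(X₀)`, i.e. `D_V W = ∑_k (V W^k + Γ^k_{ij} V^i W^j) ∂_k`.
Proof: expand `W = ∑_k W^k ∂_k` in a basis; Leibniz rule (`IsCovariantDerivativeOn.leibniz`) and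
`∇ ∂_k = Γ(∂_k)` (`leviCivita_const`). [cite: ONeill1983, Ch. 3, Prop. 3.13] -/
theorem leviCivita_apply_eq [g.HasLeviCivita] (x : U) {W : Π y : U, TangentSpace 𝓘(ℝ, E) y}
    {Wf : E → E} (hW : ∀ y : U, W y = Wf y) (hWd : DifferentiableAt ℝ Wf x) (X₀ : E) :
    g.leviCivita W x X₀ = fderiv ℝ Wf x X₀ + christoffel g G x (W x) X₀ := by
  haveI : FiniteDimensional ℝ E := inferInstance
  set b := Module.finBasis ℝ E with hb
  -- coefficient functions and constant frame
  set f : Fin (Module.finrank ℝ E) → U → ℝ := fun k y ↦ b.coord k (Wf y) with hf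
  set C : Fin (Module.finrank ℝ E) → Π y : U, TangentSpace 𝓘(ℝ, E) y := fun k _ ↦ (b k : E)
    with hC
  have hWsum : W = fun y ↦ ∑ k, (f k • C k) y := by
    funext y
    simp only [hf, hC]
    rw [hW y]
    exact (b.sum_repr (Wf y)).symm
  -- differentiability of the summands
  have hfk : ∀ k, DifferentiableAt ℝ (fun z : E ↦ b.coord k (Wf z)) x := fun k ↦
    ((b.coord k).toContinuousLinearMap.differentiableAt).comp (x : E) hWd
  have hfk' : ∀ k, MDiffAt (f k) x := fun k ↦
    (mdifferentiableAt_iff x (f k) (fun z ↦ b.coord k (Wf z)) (fun _ ↦ rfl)).2 (hfk k)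
  have hCk : ∀ k, MDiffAt (T% (C k)) x := fun k ↦ mdifferentiableAt_const_section x (b k)
  have hsmul : ∀ k, MDiffAt (T% (f k • C k)) x := fun k ↦ (hfk' k).smul_section (hCk k)
  -- derivative of the coefficients
  have hdf : ∀ k, mvfderiv 𝓘(ℝ, E) (f k) x X₀ = b.coord k (fderiv ℝ Wf x X₀) := by
    intro k
    rw [mvfderiv_eq x (f k) (fun z ↦ b.coord k (Wf z)) (fun _ ↦ rfl) (hfk k)]
    have h := ((b.coord k).toContinuousLinearMap.hasFDerivAt.comp (x : E) hWd.hasFDerivAt).fderiv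
    rw [show (fun z : E ↦ b.coord k (Wf z)) = (b.coord k).toContinuousLinearMap ∘ Wf from rfl, h]
    rfl
  -- the summands
  have hterm : ∀ k, g.leviCivita (f k • C k) x X₀ =
      b.coord k (fderiv ℝ Wf x X₀) • (b k : E) + f k x • christoffel g G x (b k) X₀ := by
    intro k
    rw [g.leviCivita.isCovariantDerivativeOn.leibniz (hCk k) (hfk' k),
      _root_.add_apply, _root_.smul_apply,
      ContinuousLinearMap.smulRight_apply, hdf k, leviCivita_const_apply hG x
        (differentiableAt_repr hG x), add_comm]
    rfl
  -- compute
  have hL : g.leviCivita W x X₀ =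
      ∑ k, (b.coord k (fderiv ℝ Wf x X₀) • (b k : E) + f k x • christoffel g G x (b k) X₀) := by
    rw [hWsum, leviCivita_finset_sum x _ _ fun k _ ↦ hsmul k]
    rw [show (∑ k, g.leviCivita (f k • C k) x) X₀ = ∑ k, g.leviCivita (f k • C k) x X₀ from by
      simp only [FunLike.coe_sum, Finset.sum_apply]]
    exact Finset.sum_congr rfl fun k _ ↦ hterm k
  have hR1 : ∑ k, b.coord k (fderiv ℝ Wf x X₀) • (b k : E) = fderiv ℝ Wf x X₀ := by
    simp only [Module.Basis.coord_apply]
    exact b.sum_repr _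
  have hR2 : ∑ k, f k x • christoffel g G x (b k) X₀ = christoffel g G x (W x) X₀ := by
    rw [← christoffel_finset_sum, hW x]
    simp only [hf, Module.Basis.coord_apply]
    rw [b.sum_repr (Wf x)]
  rw [hL, Finset.sum_add_distrib, hR1, hR2]

/-! ### The Christoffel fields -/

omit [CompleteSpace E] in
/-- Along constant fields the covariant derivative of a constant field is the Christoffel field:
`(∇_{Y₀} Z₀)(y) = Γ_y(Z₀)(Y₀)` at every point of `U`. [cite: ONeill1983, Ch. 3, Prop. 3.13] -/
theorem leviCivita_const_const_apply [g.HasLeviCivita] (y : U) (Z₀ Y₀ : E) :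
    g.leviCivita (fun _ : U ↦ (Z₀ : E)) y Y₀ = christoffel g G y Z₀ Y₀ :=
  leviCivita_const_apply hG y (differentiableAt_repr hG y) Z₀ Y₀

/-- The Christoffel field `y ↦ Γ_y(Z₀)(Y₀) = (∇_{Y₀} Z₀)(y)` is a differentiable section of `TU`
(the Levi-Civita connection of a smooth metric is locally `C¹`). [folklore] -/
theorem mdifferentiableAt_christoffel_section [g.HasLeviCivita] (x : U) (Z₀ Y₀ : E) :
    MDifferentiableAt 𝓘(ℝ, E) (𝓘(ℝ, E).prod 𝓘(ℝ, E))
      (fun y : U ↦ (TotalSpace.mk' E y (christoffel g G y Z₀ Y₀ : TangentSpace 𝓘(ℝ, E) y) :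
        TangentBundle 𝓘(ℝ, E) U)) x := by
  have hreg : g.leviCivita.IsLocallyContMDiff 1 :=
    g.isLocallyContMDiff_leviCivita_holds 1 (by exact_mod_cast le_top)
  have h := g.leviCivita.mdifferentiableAt_cov_apply hreg isOpen_univ (mem_univ x)
    (contMDiffOn_const_section univ Y₀) (contMDiffOn_const_section univ Z₀)
  refine h.congr_of_eventuallyEq (Eventually.of_forall fun y ↦ ?_)
  simp only [leviCivita_const_const_apply hG]

omit hG in
omit [CompleteSpace E] in
/-- The pairing `y ↦ g_y(Γ_y(Z₀)(Y₀), W₀)` has the representative `½ K(Z₀, Y₀, W₀)`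
(`two_mul_val_christoffel`). [cite: ONeill1983, Ch. 3, Prop. 3.13] -/
theorem val_christoffel_const (y : U) (Z₀ Y₀ W₀ : E) :
    g.val y (christoffel g G y Z₀ Y₀) W₀ = 2⁻¹ * koszulForm G y Z₀ Y₀ W₀ := by
  have h := two_mul_val_christoffel (g := g) (G := G) y Z₀ Y₀ W₀
  linarith

omit hG in
omit [FiniteDimensional ℝ E] [CompleteSpace E] in
/-- The Koszul form `y ↦ K(Z₀, Y₀, W₀)(y)` is differentiable where `G` is `C²`. [folklore] -/
theorem differentiableAt_koszulForm {x : E} (hG2 : ContDiffAt ℝ 2 G x) (Z₀ Y₀ W₀ : E) :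
    DifferentiableAt ℝ (fun y ↦ koszulForm G y Z₀ Y₀ W₀) x := by
  -- `G` is differentiable near `x`
  have hev : ∀ᶠ y in 𝓝 x, DifferentiableAt ℝ G y := by
    have h1 : ∀ᶠ y in 𝓝 x, ContDiffAt ℝ 2 G y := hG2.eventually (by simp)
    exact h1.mono fun y hy ↦ hy.differentiableAt (by norm_num)
  have hscal : ∀ a b : E, ContDiffAt ℝ 2 (fun z ↦ G z a b) x := fun a b ↦
    (hG2.clm_apply contDiffAt_const).clm_apply contDiffAt_const
  have hD : ∀ a b c : E, DifferentiableAt ℝ (fun y ↦ fderiv ℝ (fun z ↦ G z a b) y c) x :=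
    fun a b c ↦ (((hscal a b).fderiv_right (m := 1) le_rfl).differentiableAt one_ne_zero).clm_apply
      (differentiableAt_const c)
  have heq : (fun y ↦ koszulForm G y Z₀ Y₀ W₀) =ᶠ[𝓝 x] fun y ↦
      fderiv ℝ (fun z ↦ G z Z₀ W₀) y Y₀ + fderiv ℝ (fun z ↦ G z W₀ Y₀) y Z₀ -
        fderiv ℝ (fun z ↦ G z Y₀ Z₀) y W₀ := by
    filter_upwards [hev] with y hy
    rw [koszulForm_apply, ← fderiv_apply₂ G hy Z₀ W₀ Y₀, ← fderiv_apply₂ G hy W₀ Y₀ Z₀,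
      ← fderiv_apply₂ G hy Y₀ Z₀ W₀]
  exact (((hD Z₀ W₀ Y₀).add (hD W₀ Y₀ Z₀)).sub (hD Y₀ Z₀ W₀)).congr_of_eventuallyEq heq

/-! ### The Riemann tensor paired with the metric -/

/-- **The Riemann tensor in coordinates (first-kind form).** For a smooth metric on `U` with
representative `G` and vectors `X₀, Y₀, Z₀, W₀`,
`g_x(R(X₀,Y₀)Z₀, W₀) = ½ (∂_{X₀} K(Z₀,Y₀,W₀) − ∂_{Y₀} K(Z₀,X₀,W₀))(x)
   − g_x(Γ(Z₀)(Y₀), Γ(W₀)(X₀)) + g_x(Γ(Z₀)(X₀), Γ(W₀)(Y₀))`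
with `K(Z,Y,W)(y) = koszulForm G y Z Y W` (`= 2 g(∇_Y Z, W)`). This is O'Neill 1983, Ch. 3,
Lemma 3.38 (`R = ∂Γ − ∂Γ + ΓΓ − ΓΓ`) in the form obtained from `curvature_apply` on constant
fields (`[X₀, Y₀] = 0`) and metric compatibility
`g(∇_{X₀} ∇_{Y₀} Z₀, W₀) = ∂_{X₀} g(∇_{Y₀} Z₀, W₀) − g(∇_{Y₀} Z₀, ∇_{X₀} W₀)`, which avoids
differentiating the inverse metric. [cite: ONeill1983, Ch. 3, Lemma 3.38] -/
theorem val_riemann_eq [g.HasLeviCivita] (x : U) (X₀ Y₀ Z₀ W₀ : E) :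
    g.val x (g.riemann x X₀ Y₀ Z₀) W₀ =
      2⁻¹ * (fderiv ℝ (fun y ↦ koszulForm G y Z₀ Y₀ W₀) x X₀ -
        fderiv ℝ (fun y ↦ koszulForm G y Z₀ X₀ W₀) x Y₀)
      - g.val x (christoffel g G x Z₀ Y₀) (christoffel g G x W₀ X₀)
      + g.val x (christoffel g G x Z₀ X₀) (christoffel g G x W₀ Y₀) := by
  haveI : IsManifold 𝓘(ℝ, E) (minSmoothness ℝ 3) U := by
    rw [minSmoothness_of_isRCLikeNormedField]; infer_instance
  have hm2 : minSmoothness ℝ 2 = 2 := minSmoothness_of_isRCLikeNormedField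
  have h2i : (2 : ℕ∞ω) ≤ ∞ := WithTop.coe_le_coe.mpr le_top
  have hreg : g.leviCivita.IsLocallyContMDiff 1 :=
    g.isLocallyContMDiff_leviCivita_holds 1 (by exact_mod_cast le_top)
  have hLC : g.IsLeviCivita g.leviCivita := g.isLeviCivita_leviCivita_holds
  -- constant fields
  set Xc : Π y : U, TangentSpace 𝓘(ℝ, E) y := fun _ ↦ (X₀ : E) with hXc
  set Yc : Π y : U, TangentSpace 𝓘(ℝ, E) y := fun _ ↦ (Y₀ : E) with hYc
  set Zc : Π y : U, TangentSpace 𝓘(ℝ, E) y := fun _ ↦ (Z₀ : E) with hZc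
  set Wc : Π y : U, TangentSpace 𝓘(ℝ, E) y := fun _ ↦ (W₀ : E) with hWc
  -- (1) `curvature_apply` on constant fields; the bracket vanishes
  have hR : g.riemann x X₀ Y₀ Z₀ =
      g.leviCivita (fun y ↦ g.leviCivita Zc y Y₀) x X₀ -
        g.leviCivita (fun y ↦ g.leviCivita Zc y X₀) x Y₀ := by
    have h := g.leviCivita.curvature_apply_of_isLocallyContMDiff (x := x) hreg (X := Xc) (Y := Yc)
      (Z := Zc) (mdifferentiableAt_const_section x X₀) (mdifferentiableAt_const_section x Y₀)
      (by rw [hm2]; exact contMDiffAt_const_section x Z₀)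
    change g.riemann x X₀ Y₀ Z₀ = _ at h
    rw [h]
    simp only [CovariantDerivative.curvatureAux, hXc, hYc, mlieBracket_const, map_zero, sub_zero]
  -- (2) the Christoffel fields and their pairings
  have hS : ∀ V₀ : E, (fun y : U ↦ g.leviCivita Zc y V₀) =
      fun y : U ↦ (christoffel g G y Z₀ V₀ : E) := fun V₀ ↦
    funext fun y ↦ leviCivita_const_const_apply hG y Z₀ V₀
  have hSd : ∀ V₀ : E, MDifferentiableAt 𝓘(ℝ, E) (𝓘(ℝ, E).prod 𝓘(ℝ, E))
      (fun y : U ↦ (TotalSpace.mk' E y (christoffel g G y Z₀ V₀ : TangentSpace 𝓘(ℝ, E) y) :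
        TangentBundle 𝓘(ℝ, E) U)) x := fun V₀ ↦
    mdifferentiableAt_christoffel_section hG x Z₀ V₀
  -- (3) metric compatibility against the constant field `W₀`
  have hcompat : ∀ V₀ T₀ : E,
      g.val x (g.leviCivita (fun y : U ↦ (christoffel g G y Z₀ V₀ : E)) x T₀) W₀ =
        fderiv ℝ (fun y ↦ 2⁻¹ * koszulForm G y Z₀ V₀ W₀) x T₀ -
          g.val x (christoffel g G x Z₀ V₀) (christoffel g G x W₀ T₀) := by
    intro V₀ T₀
    have hc := hLC.2 (x := x) (X := fun _ : U ↦ (T₀ : E))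
      (Y := fun y : U ↦ (christoffel g G y Z₀ V₀ : E)) (Z := Wc)
      (mdifferentiableAt_const_section x T₀) (hSd V₀) (mdifferentiableAt_const_section x W₀)
    -- the paired function and its derivative
    have hrep : ∀ y : U, g.val y (christoffel g G y Z₀ V₀) (Wc y) =
        (fun z : E ↦ 2⁻¹ * koszulForm G z Z₀ V₀ W₀) y := fun y ↦
      val_christoffel_const (g := g) (G := G) y Z₀ V₀ W₀
    have hdiff : DifferentiableAt ℝ (fun z : E ↦ 2⁻¹ * koszulForm G z Z₀ V₀ W₀) x :=
      (differentiableAt_koszulForm ((contDiffAt_repr hG x).of_le h2i) Z₀ V₀ W₀).const_mul _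
    rw [mvfderiv_eq x _ _ hrep hdiff] at hc
    simp only [hWc] at hc
    rw [leviCivita_const_const_apply hG x W₀ T₀] at hc
    linarith
  -- (4) assemble
  rw [hR, map_sub, _root_.sub_apply, hS Y₀, hS X₀, hcompat Y₀ X₀, hcompat X₀ Y₀,
    fderiv_const_mul (differentiableAt_koszulForm ((contDiffAt_repr hG x).of_le h2i) ..),
    fderiv_const_mul (differentiableAt_koszulForm ((contDiffAt_repr hG x).of_le h2i) ..)]
  simp only [_root_.smul_apply, smul_eq_mul]
  ring

end OpensChart

end Literature.Geometry.Lorentzian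

end
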